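import Literature.Geometry.Lorentzian.ModelData
import Literature.Geometry.Lorentzian.ModelDataProofs
import HarnessLib

/-!
# Minkowski slice: `∂ₜ` is the future unit normal of `{t = 0}` (discharge)

`Literature.Geometry.Lorentzian.ModelData` vendors, as the named fact
`Minkowski.isFutureUnitNormal_sliceNormal` (a field of `Minkowski.DevelopmentFacts`), that the
constant field `∂ₜ` along the slice embedding `y ↦ (0, y)` of `{t = 0} ≅ ℝ³` into Minkowski
spacetime `(ℝ⁴, η, ∂ₜ)` is its future unit normal: `η(∂ₜ, d(sliceEmbed) v) = η(∂ₜ, (0, v)) = 0`,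
`η(∂ₜ, ∂ₜ) = −1`, and `∂ₜ` is future-directed (it is the orienting field itself). This file
discharges it (`Minkowski.isFutureUnitNormal_sliceNormal_holds`), from the differential of the
slice embedding `mfderiv_sliceEmbed_apply` (`ModelDataProofs`) and `η(∂ₜ, ∂ₜ) = −1`
(`Minkowski.bilin_basisVector_zero`, `KerrSchild`). Together with the discharged fields
`isSmoothEmbedding_sliceEmbed_holds` (`ModelData`), `pullbackBilin_sliceEmbed_holds`,
`secondFundamentalForm_sliceEmbed_holds` (`ModelDataProofs`) and `isRicciFlat_holds`
(`MinkowskiFlat`), every field of `Minkowski.DevelopmentFacts` except the *false* Cauchy-surface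
field `isCauchySurface_range_sliceEmbed` (`MinkowskiCauchyDefect`) is now a theorem.

No definitions or named facts are introduced (theorems only); `ModelData.lean` is unchanged.

## References

* S. W. Hawking, G. F. R. Ellis, *The large scale structure of space-time*, CUP 1973, §5.1,
  p. 118 (Minkowski space, the surfaces `{x⁴ = const}`).
* R. M. Wald, *General Relativity*, Chicago 1984, §10.2, (10.2.10)–(10.2.13) (unit normal
  `nᵃ`, induced metric and extrinsic curvature of a spacelike hypersurface).
* B. O'Neill, *Semi-Riemannian geometry*, Academic Press 1983, Ch. 4, pp. 106–107 (sign of a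
  hypersurface, unit normal), Ch. 5, p. 145 (future-directed).
-/

noncomputable section

open Set Manifold
open scoped ContDiff

namespace Literature.Geometry.Lorentzian

namespace Minkowski

/-- `η(∂ₜ, (0, v)) = 0`: the time axis is `η`-orthogonal to the slice `{t = 0}`.
Hawking–Ellis 1973, §5.1, p. 118, (5.2). [cite: HawkingEllis1973, §5.1 p. 118 (5.2)] -/
theorem bilin_basisVector_zero_ofTimeSpace_zero (v : E3) :
    bilin (E4.basisVector 0) (E4.ofTimeSpace 0 v) = 0 := by
  rw [bilin_apply]
  simp [E4.ofTimeSpace_apply_zero, Fin.succ_ne_zero]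

/-- `∂ₜ` is `η`-normal to the slice embedding `y ↦ (0, y)`: `η(∂ₜ, d(sliceEmbed)_y v) = 0` for
every tangent vector `v` of the slice (`d(sliceEmbed)_y v = (0, v)`, `mfderiv_sliceEmbed_apply`).
Wald 1984, §10.2; Hawking–Ellis 1973, §5.1. [cite: Wald1984, §10.2] -/
theorem isNormalTo_sliceNormal :
    smoothMetric.toPseudoRiemannianMetric.IsNormalTo 𝓘(ℝ, E3) sliceEmbed sliceNormal := by
  intro y v
  rw [smoothMetric_val, sliceNormal_apply, mfderiv_sliceEmbed_apply]
  exact bilin_basisVector_zero_ofTimeSpace_zero v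

/-- `∂ₜ` is a unit normal of sign `−1` (timelike) of the slice embedding: normal and
`η(∂ₜ, ∂ₜ) = −1`. O'Neill 1983, Ch. 4, pp. 106–107; Wald 1984, §10.2. [cite: Wald1984, §10.2] -/
theorem isUnitNormal_sliceNormal :
    smoothMetric.toPseudoRiemannianMetric.IsUnitNormal 𝓘(ℝ, E3) sliceEmbed sliceNormal (-1) := by
  refine ⟨isNormalTo_sliceNormal, fun y ↦ ?_⟩
  rw [smoothMetric_val, sliceNormal_apply]
  exact bilin_basisVector_zero

/-- `∂ₜ` is future-directed for the time orientation `∂ₜ` of Minkowski spacetime (the orienting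
field is future-directed, `TimeOrientation.isFutureDirected_vectorField`). O'Neill 1983, Ch. 5,
p. 145. [cite: ONeill1983, Ch. 5, p. 145] -/
theorem isFutureDirected_sliceNormal (y : slice) :
    (timeOrientation.ofLE (n' := ∞) le_top).IsFutureDirected (x := sliceEmbed y) (sliceNormal y) :=
  (timeOrientation.ofLE (n' := ∞) le_top).isFutureDirected_vectorField (sliceEmbed y)

/-- **Discharge of the named fact `Minkowski.isFutureUnitNormal_sliceNormal`** (a field of
`Minkowski.DevelopmentFacts`, `ModelData`): `∂ₜ` is the future unit normal of `{t = 0}` in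
Minkowski spacetime — `η(∂ₜ, (0, v)) = 0`, `η(∂ₜ, ∂ₜ) = −1`, and `∂ₜ` is future-directed, being
the orienting field itself. Hawking–Ellis 1973, §5.1, p. 118; Wald 1984, §10.2,
(10.2.10)–(10.2.11). [cite: HawkingEllis1973, §5.1] -/
theorem isFutureUnitNormal_sliceNormal_holds : isFutureUnitNormal_sliceNormal :=
  ⟨isUnitNormal_sliceNormal, isFutureDirected_sliceNormal⟩

end Minkowski

end Literature.Geometry.Lorentzian

end
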